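/-
COR-CM (cells pub-hodgecm / pub-hodgecm2, stage 2 of the Hodge ladder) — TRANSPOSITION SURGE, item (vi) sub-binder S2: STRENGTH and
CONSISTENCY CERTIFICATE of the pinned as-printed junction `Transposition/Item6SupplyPinned.lean` (pub-hodgecm2 lead ACK
2026-08-21T15:19:39Z, conditions (i)–(ii); coordinator ruling 2026-08-21T15:33:56Z (3) «T5 consistency guard»).  Seat
prover-pub-hodgecm-own-htheta-g3-0 (own-htheta gen 3).  Theorems only; nothing asserted; no proof holes.  FRAMING: HC_CM is NOT proved.
-/
import Summits.HodgeConjecture.CorCM.B01.Transposition.Item6SupplyPinned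
import Summits.HodgeConjecture.CorCM.B01.Transposition.Item2Holds
import Literature.NumberTheory.Automorphic.GKModulesAdmissible
import HarnessLib

/-!
# The pinned junction: its eight binders are jointly as strong as B01-S, and are Shimura-freely inhabited modulo B01-S

`Item6SupplyPinned.lean` derives B01-S `U.FaceSupply` (hence the S2 supply clause of item (vi), hence — with `hD` — `HC_CM`) from
EIGHT binders over a consumer's Liu datum `D` and pin `Aμ`: `hLiu` ([Liu2021] Thm. 4.18 AS PRINTED), the carriers `hObj` / `hChi` /
`hirr` + `hsm` (Def. 4.11 «irreducible admissible», verbatim), the choice `hμ` (`Φ_μ = Φ^{*ι₁}`), `hCM` (Def. 4.5 (2) + Def. 4.3 (2) at the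
dictionary) and `hReach` (§4.2 + App. C Prop. C.5 read with the non-Liu inputs (h2) Deligne uniformisation / (h3) Chow–GAGA / (h4) Albanese
functoriality — the tagged S2-CRUX (M-Sh); see that file's module docstring).  This file certifies, IN THE KERNEL (`U = picardCMUniverse hHD hI h₁ h₃`):

* §1 `Model.pinned_binders_of_faceSupply` — for EVERY datum `D` with `hLiu` (only its item (1) threshold is used), `hObj` and `hμ`, B01-S
  alone yields a pin satisfying (hCM, hReach): the
  TRIVIAL pin `Aμ := A_{(F,Φ)} = (cmRealisation h₃ (cmCode F Φ)).AV` — which no auditor would accept as `A_μ ⊗_{E,ι₁} ℂ`, but which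
  the TYPING admits — realises `Φ` = the type induced from the reflex pair `(K*, Φ_μ*)` of `Φ_μ = Φ^{*ι₁}` along `K* ⊆ F ≅ (cmCode F Φ).E`
  (binder-1's `CMReach.inducedCMType_reflexField_val_reflexCMType_of_isInverse`, Shimura 1998 §8.3 Prop. 28, tree theorem), and
  its `hReach` consequent follows from B01-S (`faceSupply_iff_typewise`, `Motives.nonempty_jacobian_of_isSmoothProjective_complex_of_dim`,
  row D0 `picardCMUniverse_Uiso_ne_bot_iff_exists_hom_ne_zero` — the argument of tr-prover-6's `thm418AsPrinted_match_of_faceSupply`).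
* §2 `Model.exists_pin_iff_faceSupply` — STRENGTH (lead condition (ii)): given `hLiu`/`hObj`/`hChi`/`hirr`/`hsm`/`hμ`, «some pin satisfies
  (hCM, hReach)» ↔ `U.FaceSupply`.  AGAIN ↔ B01-S: the pin adds no kernel content toward S2; it re-classifies the residual.
* §3 `Model.exists_pinnedDatum_of_faceSupply` — NON-VACUITY of the Liu side at the pinned shape: a Shimura-free datum (token
  carriers `PUnit`, `ω := ℂ`, `Ω := HomK := M_μ`, trivial actions — tr-prover-6's `exists_datum_liuSide_binders` construction) whose
  REAL `μ` is a weight-one conjugate symplectic character OF CM TYPE `Φ^{*ι₁}` (`IdeleClassGroup.exists_isConjugateSymplectic_hasCMType`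
  at item (ii)'s `Transposition.invType ι₁ Φ`) satisfies `hLiu` AS TYPED, `hObj`, `hChi`, `hirr` (a one-dimensional representation is irreducible), `hsm` AND `hμ`; with §1, B01-S ⟹ all eight.
* §4 `Model.exists_pinnedDatum_iff_faceSupply` (and `_rec` on the universe of record) — CONSISTENCY, relative form (lead condition
  (i) / ruling (3) T5): «some `(D, Aμ)` satisfies all eight binders» ↔ `U.FaceSupply`.  Hence the binder family of the pinned junction
  derives `False` iff B01-S is REFUTABLE on `U`; the x2 refutation route (`probe_x2_s2junction_t1.lean` v2/v4: `F₀ = ℚ(ζ₄)`, isotropic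
  code, `H¹ = 0`) is closed by the guard `6 ≤ [F:ℚ]` (stuck goal `⊢ 6 ≤ Module.finrank ℚ F₀.K`, i.e. `6 ≤ 2`), exactly as for the
  guarded `hMatch` family (`X2S2T1.exists_rescoped_iff_socketReach`, `X2S2T1.exists_pinned_iff_socketReach`); independently
  re-run ON THE v4 BINDER TEXTS by htheta-x2 g3, 2026-08-21T16:00:05Z (memo `pub-hodgecm-own-htheta/x2/PINNED-JUNCTION-T1-v4.md`
  5e87ef24cf9a: refutation attempt rc 1, stuck `⊢ 6 ≤ Module.finrank ℚ F₀.K`; `(∃ D Aμ, eight binders) ↔ SocketReach ↔ U.FaceSupply`,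
  31/31 axioms trio) — the «T5»-style line of record for this pair of files until `pub-hodgecm2-t5-consist-1` posts its own.

A statement about the TYPING (the consumer's carriers can be chosen degenerately), not about Liu's objects.  HC_CM is NOT proved.

References: Y. Liu, Camb. J. Math. 9 (2021) = arXiv:2102.11518, Def. 4.3 (2), Def. 4.5 (2), Prop. 4.6 (1), Def. 4.11, Def. 4.12,
Def. 4.16, Thm. 4.18, App. C Prop. C.5; G. Shimura, *Abelian Varieties with Complex Multiplication and Modular Functions* (1998) §6,
§8.3 Prop. 28.
-/

noncomputable section

open scoped TensorProduct InnerProductSpace DirectSum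

namespace Summit.HodgeConjecture.CorCM.Model

open CategoryTheory AlgebraicGeometry NumberField TensorProduct DirectSum
open Literature.AlgebraicGeometry.Motives
open Literature.AlgebraicGeometry.HodgeTheory
open Literature.AlgebraicGeometry.ComplexMultiplication (IsCMTypeRealisation)
open Literature.NumberTheory.ComplexMultiplication
open Literature.NumberTheory.Automorphic
open Literature.NumberTheory.Automorphic.PicardCM
open Literature.NumberTheory.Automorphic.Liu2021

section Data

/-! ## §1  B01-S ⟹ (hCM, hReach) at the trivial pin -/

/-- **B01-S ⟹ (hCM, hReach) at the TRIVIAL pin `Aμ := A_{(F,Φ)}`** (`U = picardCMUniverse hHD hI h₁ h₃`), for EVERY datum `D` whose `μ` has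
CM type `Φ^{*ι₁}` (`hμ`), using of `hLiu`/`hObj` only the open compact threshold `K₀` of item (1) (as `Ksm`): `hCM` with `M := (cmCode F Φ).E`, `e := (cmCodeEquiv F Φ) ∘ (K* ⊆ F)` — the type
induced along `e` from the reflex pair of `Φ_μ = Φ^{*ι₁}` is the coded `Φ` (binder-1's `CMReach.inducedCMType_reflexField_val_reflexCMType_of_isInverse`
+ `inducedCMType_comp`; the coded type is `Φ` along the code isomorphism by `rfl`), realised by `Milne1999.cmRealisation_isCMTypeRealisation`;
`hReach` because its consequent follows from `U.FaceSupply` alone (tr-prover-6's `thm418AsPrinted_match_of_faceSupply` argument).  A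
statement about the TYPING. [cite: Shimura1998, §8.3 Prop. 28] -/
theorem pinned_binders_of_faceSupply
    (hHD : exists_isReal_hodgeModel) (hI : hodgePQ_independent_of_hodgeModel)
    (h₁ : BallQuotientUniformised) (h₃ : CMAbelianVarietyRealised)
    (D : ∀ (F : CMField) (ι₁ : F →+* ℂ) (_ : HermSpace3 F ι₁) (_ : CMType F), Thm418Data (maximalRealSubfield F) F)
    (hLiu : ∀ (F : CMField), IsGalois ℚ F → 6 ≤ Module.finrank ℚ F → ∀ (Φ : CMType F) (ι₁ : F →+* ℂ), ι₁ ∈ Φ.1 →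
      ∀ V : HermSpace3 F ι₁, Thm418AsPrinted (D F ι₁ V Φ))
    (hObj : ∀ (F : CMField), IsGalois ℚ F → 6 ≤ Module.finrank ℚ F → ∀ (Φ : CMType F) (ι₁ : F →+* ℂ), ι₁ ∈ Φ.1 →
      ∀ V : HermSpace3 F ι₁, Nonempty (D F ι₁ V Φ).Obj)
    (hμ : ∀ (F : CMField), IsGalois ℚ F → 6 ≤ Module.finrank ℚ F → ∀ (Φ : CMType F) (ι₁ : F →+* ℂ), ι₁ ∈ Φ.1 →
      ∀ (V : HermSpace3 F ι₁) (g : F ≃ₐ[ℚ] F),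
        ι₁.comp (g : F →+* F) ∈ (D F ι₁ V Φ).cmType.1 ↔ ι₁.comp (g.symm : F →+* F) ∈ Φ.1)
    (hS : (picardCMUniverse hHD hI h₁ h₃).FaceSupply) :
    ∃ Aμ : ∀ (F : CMField) (ι₁ : F →+* ℂ) (V : HermSpace3 F ι₁) (Φ : CMType F), (D F ι₁ V Φ).Obj → AbelianVariety ℂ,
      (∀ (F : CMField) [IsGalois ℚ F], 6 ≤ Module.finrank ℚ F → ∀ (Φ : CMType F) (ι₁ : F →+* ℂ), ι₁ ∈ Φ.1 →
        ∀ (V : HermSpace3 F ι₁) (Dμ : (D F ι₁ V Φ).Obj),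
          ∃ (M : Type) (_ : Field M) (_ : NumberField M) (_ : IsCMField M)
            (e : reflexField ℚ F (algValuedIn ι₁ (D F ι₁ V Φ).cmType.1) →+* M)
            (ιB : 𝓞 M →+* End (Aμ F ι₁ V Φ Dμ)) (θB : M →+* Module.End ℂ (complexBetti (Aμ F ι₁ V Φ Dμ).X 1)),
            IsCMTypeRealisation (inducedCMType e (reflexCMType ι₁ (D F ι₁ V Φ).cmType (AlgHom.id ℚ F))) (Aμ F ι₁ V Φ Dμ) ιB θB) ∧
      (∀ (F : CMField), IsGalois ℚ F → 6 ≤ Module.finrank ℚ F → ∀ (Φ : CMType F) (ι₁ : F →+* ℂ), ι₁ ∈ Φ.1 →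
        ∀ V : HermSpace3 F ι₁, ∃ Ksm : Subgroup (D F ι₁ V Φ).G, IsOpenCompact Ksm ∧
          ∀ (K : Subgroup (D F ι₁ V Φ).G) (Dμ : (D F ι₁ V Φ).Obj) (φ : (D F ι₁ V Φ).HomK K Dμ),
            IsOpenCompact K → K ≤ Ksm → φ ≠ 0 →
              ∃ (Γ : Level V) (𝒥 : Jacobian (Var.scheme (ballQuotientUniformisedDatum_of h₁) h₃ (.pms (pmsCode F ι₁ V Γ))))
                (w : 𝒥.J ⟶ Aμ F ι₁ V Φ Dμ), w ≠ 0) := by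
  refine ⟨fun F _ _ Φ _ => (cmRealisation h₃ (cmCode F Φ)).AV, ?_, ?_⟩
  · -- hCM at the trivial pin
    intro F hG h6 Φ ι₁ hι V Dμ
    have hind : inducedCMType (((cmCodeEquiv F Φ).toRingHom).comp
          ((reflexField ℚ F (algValuedIn ι₁ (D F ι₁ V Φ).cmType.1)).val :
            reflexField ℚ F (algValuedIn ι₁ (D F ι₁ V Φ).cmType.1) →+* F))
          (reflexCMType ι₁ (D F ι₁ V Φ).cmType (AlgHom.id ℚ F)) = (cmCode F Φ).Φ := by
      rw [inducedCMType_comp, CMReach.inducedCMType_reflexField_val_reflexCMType_of_isInverse ι₁ (hμ F hG h6 Φ ι₁ hι V)]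
      rfl
    have hB := Literature.AlgebraicGeometry.Milne1999.cmRealisation_isCMTypeRealisation h₃ (cmCode F Φ)
    rw [← hind] at hB
    exact ⟨(cmCode F Φ).E, inferInstance, inferInstance, inferInstance, _, (cmRealisation h₃ (cmCode F Φ)).ι,
      (cmRealisation h₃ (cmCode F Φ)).θ, hB⟩
  · -- hReach at the trivial pin: a threshold from item (1), then B01-S gives a non-zero `Alb(P_Γ(V)) → A_{(F,Φ)}` at some level
    intro F hG h6 Φ ι₁ hι V
    obtain ⟨Dμ⟩ := hObj F hG h6 Φ ι₁ hι V
    obtain ⟨K₀, hK₀, -⟩ := Thm418Data.exists_injective_res (hLiu F hG h6 Φ ι₁ hι V) Dμ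
    refine ⟨K₀, hK₀, fun _ _ _ _ _ _ => ?_⟩
    obtain ⟨Γ, ω, hω, hω0⟩ := (faceSupply_iff_typewise hHD hI h₁ h₃).1 hS F hG h6 Φ ι₁ hι V
    obtain ⟨𝒥⟩ := nonempty_jacobian_of_isSmoothProjective_complex_of_dim _
      (Var.isSmoothProjective (ballQuotientUniformisedDatum_of h₁) h₃ (.pms (pmsCode F ι₁ V Γ)))
    have hne : (picardCMUniverse hHD hI h₁ h₃).Uiso Γ F Φ ι₁ ≠ ⊥ := (Submodule.ne_bot_iff _).2 ⟨ω, hω, hω0⟩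
    obtain ⟨u, hu⟩ := (picardCMUniverse_Uiso_ne_bot_iff_exists_hom_ne_zero Γ F Φ hι 𝒥).1 hne
    exact ⟨Γ, 𝒥, u, hu⟩

/-! ## §2  STRENGTH: given the Liu side and the choice of `μ`, «∃ pin» ↔ B01-S -/

/-- **STRENGTH CERTIFICATE** (`U = picardCMUniverse hHD hI h₁ h₃`; pub-hodgecm2 lead ACK condition (ii)): GIVEN `hLiu` ([Liu2021] Thm. 4.18
as printed for the consumer's data), the carriers `hObj` / `hChi` / `hirr` / `hsm` and the choice `hμ` — all intended TRUE —, «SOME pin `Aμ`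
satisfies (hCM, hReach)» is LOGICALLY EQUIVALENT to the displayed leaf B01-S `U.FaceSupply` (⇒ `faceSupply_of_thm418AsPrinted_pinned`;
⇐ `pinned_binders_of_faceSupply`, no witness).  AGAIN ↔ B01-S (hence ↔ x2's `SocketReach`): the pinned display adds no kernel content
toward S2 — uniform in `[F:ℚ] ≥ 6` and in the face —; it RE-CLASSIFIES the residual at the intended instantiation (`Aμ D_μ := A_μ ⊗_{E,ι₁} ℂ`)
into the choice `hμ` and two consequence-readings of PRINTED [Liu2021] sentences.  HC_CM is NOT proved. [folklore] -/
theorem exists_pin_iff_faceSupply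
    (hHD : exists_isReal_hodgeModel) (hI : hodgePQ_independent_of_hodgeModel)
    (h₁ : BallQuotientUniformised) (h₃ : CMAbelianVarietyRealised)
    (D : ∀ (F : CMField) (ι₁ : F →+* ℂ) (_ : HermSpace3 F ι₁) (_ : CMType F), Thm418Data (maximalRealSubfield F) F)
    (hLiu : ∀ (F : CMField), IsGalois ℚ F → 6 ≤ Module.finrank ℚ F → ∀ (Φ : CMType F) (ι₁ : F →+* ℂ), ι₁ ∈ Φ.1 →
      ∀ V : HermSpace3 F ι₁, Thm418AsPrinted (D F ι₁ V Φ))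
    (hObj : ∀ (F : CMField), IsGalois ℚ F → 6 ≤ Module.finrank ℚ F → ∀ (Φ : CMType F) (ι₁ : F →+* ℂ), ι₁ ∈ Φ.1 →
      ∀ V : HermSpace3 F ι₁, Nonempty (D F ι₁ V Φ).Obj)
    (hChi : ∀ (F : CMField), IsGalois ℚ F → 6 ≤ Module.finrank ℚ F → ∀ (Φ : CMType F) (ι₁ : F →+* ℂ), ι₁ ∈ Φ.1 →
      ∀ V : HermSpace3 F ι₁, Nonempty (D F ι₁ V Φ).Chi)
    (hirr : ∀ (F : CMField), IsGalois ℚ F → 6 ≤ Module.finrank ℚ F → ∀ (Φ : CMType F) (ι₁ : F →+* ℂ), ι₁ ∈ Φ.1 →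
      ∀ (V : HermSpace3 F ι₁) (i : (D F ι₁ V Φ).AdmIndex), ((D F ι₁ V Φ).rhoAt i).IsIrreducible)
    (hsm : ∀ (F : CMField), IsGalois ℚ F → 6 ≤ Module.finrank ℚ F → ∀ (Φ : CMType F) (ι₁ : F →+* ℂ), ι₁ ∈ Φ.1 →
      ∀ (V : HermSpace3 F ι₁) (i : (D F ι₁ V Φ).AdmIndex) (v : (D F ι₁ V Φ).omegaAt i),
        ∃ S : Subgroup (D F ι₁ V Φ).G, IsOpen (S : Set (D F ι₁ V Φ).G) ∧ ∀ k ∈ S, (D F ι₁ V Φ).rhoAt i k v = v)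
    (hμ : ∀ (F : CMField), IsGalois ℚ F → 6 ≤ Module.finrank ℚ F → ∀ (Φ : CMType F) (ι₁ : F →+* ℂ), ι₁ ∈ Φ.1 →
      ∀ (V : HermSpace3 F ι₁) (g : F ≃ₐ[ℚ] F),
        ι₁.comp (g : F →+* F) ∈ (D F ι₁ V Φ).cmType.1 ↔ ι₁.comp (g.symm : F →+* F) ∈ Φ.1) :
    (∃ Aμ : ∀ (F : CMField) (ι₁ : F →+* ℂ) (V : HermSpace3 F ι₁) (Φ : CMType F), (D F ι₁ V Φ).Obj → AbelianVariety ℂ,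
      (∀ (F : CMField) [IsGalois ℚ F], 6 ≤ Module.finrank ℚ F → ∀ (Φ : CMType F) (ι₁ : F →+* ℂ), ι₁ ∈ Φ.1 →
        ∀ (V : HermSpace3 F ι₁) (Dμ : (D F ι₁ V Φ).Obj),
          ∃ (M : Type) (_ : Field M) (_ : NumberField M) (_ : IsCMField M)
            (e : reflexField ℚ F (algValuedIn ι₁ (D F ι₁ V Φ).cmType.1) →+* M)
            (ιB : 𝓞 M →+* End (Aμ F ι₁ V Φ Dμ)) (θB : M →+* Module.End ℂ (complexBetti (Aμ F ι₁ V Φ Dμ).X 1)),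
            IsCMTypeRealisation (inducedCMType e (reflexCMType ι₁ (D F ι₁ V Φ).cmType (AlgHom.id ℚ F))) (Aμ F ι₁ V Φ Dμ) ιB θB) ∧
      (∀ (F : CMField), IsGalois ℚ F → 6 ≤ Module.finrank ℚ F → ∀ (Φ : CMType F) (ι₁ : F →+* ℂ), ι₁ ∈ Φ.1 →
        ∀ V : HermSpace3 F ι₁, ∃ Ksm : Subgroup (D F ι₁ V Φ).G, IsOpenCompact Ksm ∧
          ∀ (K : Subgroup (D F ι₁ V Φ).G) (Dμ : (D F ι₁ V Φ).Obj) (φ : (D F ι₁ V Φ).HomK K Dμ),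
            IsOpenCompact K → K ≤ Ksm → φ ≠ 0 →
              ∃ (Γ : Level V) (𝒥 : Jacobian (Var.scheme (ballQuotientUniformisedDatum_of h₁) h₃ (.pms (pmsCode F ι₁ V Γ))))
                (w : 𝒥.J ⟶ Aμ F ι₁ V Φ Dμ), w ≠ 0)) ↔
      (picardCMUniverse hHD hI h₁ h₃).FaceSupply :=
  ⟨fun ⟨Aμ, hCM, hReach⟩ => faceSupply_of_thm418AsPrinted_pinned hHD hI h₁ h₃ D Aμ hLiu hObj hChi hirr hsm hμ hCM hReach,
    pinned_binders_of_faceSupply hHD hI h₁ h₃ D hLiu hObj hμ⟩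

/-! ## §3  NON-VACUITY of the Liu side at the pinned shape, modulo B01-S -/

/-- **B01-S ⟹ ALL EIGHT binders of the pinned junction, for SOME Shimura-free `(D, Aμ)`** (`U = picardCMUniverse hHD hI h₁ h₃`).  The
datum: token carriers (`𝕍 := G := Eps := Chi := Obj := PUnit`, `ω(μ,ε,χ) := ℂ` with the trivial action, `Ω(μ) := Hom_E(A_K,A_μ)_ℚ := M_μ`,
`res := id`) around a REAL weight-one conjugate symplectic character `μ` of `F` whose CM type is `Φ^{*ι₁}` when `F/ℚ` is Galois
(`IdeleClassGroup.exists_isConjugateSymplectic_hasCMType` at item (ii)'s `Transposition.invType ι₁ Φ`; any type otherwise).  For it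
[Liu2021] Thm. 4.18 AS TYPED holds (`ℂ ⊗_{M_μ} M_μ ≃ ℂ ≃ ⨁_{one index} ℂ`, the index set a singleton because a `μ`-admissible `ε` EXISTS,
`Liu2021.exists_isAdmissibleElement_of_cmType`, over one-point `Eps × Chi` — tr-prover-6's `exists_datum_liuSide_binders`, re-run with
the type pinned), and so do `hObj`, `hChi`, `hirr` (`isIrreducible_of_finrank_eq_one'`), `hsm`, `hμ`; the pin with (hCM, hReach) is §1's.  CONSEQUENCE for the audit: the eight binders
are jointly satisfiable as soon as B01-S holds, WITHOUT any Shimura-variety content on the Liu side — all kernel content of the pinned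
display sits in (hμ, hCM, hReach) at the INTENDED instantiation, and in content it is B01-S.  A statement about the TYPING. [folklore] -/
theorem exists_pinnedDatum_of_faceSupply
    (hHD : exists_isReal_hodgeModel) (hI : hodgePQ_independent_of_hodgeModel)
    (h₁ : BallQuotientUniformised) (h₃ : CMAbelianVarietyRealised)
    (hS : (picardCMUniverse hHD hI h₁ h₃).FaceSupply) :
    ∃ (D : ∀ (F : CMField) (ι₁ : F →+* ℂ) (_ : HermSpace3 F ι₁) (_ : CMType F), Thm418Data (maximalRealSubfield F) F)
        (Aμ : ∀ (F : CMField) (ι₁ : F →+* ℂ) (V : HermSpace3 F ι₁) (Φ : CMType F), (D F ι₁ V Φ).Obj → AbelianVariety ℂ),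
      (∀ (F : CMField), IsGalois ℚ F → 6 ≤ Module.finrank ℚ F → ∀ (Φ : CMType F) (ι₁ : F →+* ℂ), ι₁ ∈ Φ.1 →
        ∀ V : HermSpace3 F ι₁, Thm418AsPrinted (D F ι₁ V Φ)) ∧
      (∀ (F : CMField), IsGalois ℚ F → 6 ≤ Module.finrank ℚ F → ∀ (Φ : CMType F) (ι₁ : F →+* ℂ), ι₁ ∈ Φ.1 →
        ∀ V : HermSpace3 F ι₁, Nonempty (D F ι₁ V Φ).Obj) ∧
      (∀ (F : CMField), IsGalois ℚ F → 6 ≤ Module.finrank ℚ F → ∀ (Φ : CMType F) (ι₁ : F →+* ℂ), ι₁ ∈ Φ.1 →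
        ∀ V : HermSpace3 F ι₁, Nonempty (D F ι₁ V Φ).Chi) ∧
      (∀ (F : CMField), IsGalois ℚ F → 6 ≤ Module.finrank ℚ F → ∀ (Φ : CMType F) (ι₁ : F →+* ℂ), ι₁ ∈ Φ.1 →
        ∀ (V : HermSpace3 F ι₁) (i : (D F ι₁ V Φ).AdmIndex), ((D F ι₁ V Φ).rhoAt i).IsIrreducible) ∧
      (∀ (F : CMField), IsGalois ℚ F → 6 ≤ Module.finrank ℚ F → ∀ (Φ : CMType F) (ι₁ : F →+* ℂ), ι₁ ∈ Φ.1 →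
        ∀ (V : HermSpace3 F ι₁) (i : (D F ι₁ V Φ).AdmIndex) (v : (D F ι₁ V Φ).omegaAt i),
          ∃ S : Subgroup (D F ι₁ V Φ).G, IsOpen (S : Set (D F ι₁ V Φ).G) ∧ ∀ k ∈ S, (D F ι₁ V Φ).rhoAt i k v = v) ∧
      (∀ (F : CMField), IsGalois ℚ F → 6 ≤ Module.finrank ℚ F → ∀ (Φ : CMType F) (ι₁ : F →+* ℂ), ι₁ ∈ Φ.1 →
        ∀ (V : HermSpace3 F ι₁) (g : F ≃ₐ[ℚ] F),
          ι₁.comp (g : F →+* F) ∈ (D F ι₁ V Φ).cmType.1 ↔ ι₁.comp (g.symm : F →+* F) ∈ Φ.1) ∧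
      (∀ (F : CMField) [IsGalois ℚ F], 6 ≤ Module.finrank ℚ F → ∀ (Φ : CMType F) (ι₁ : F →+* ℂ), ι₁ ∈ Φ.1 →
        ∀ (V : HermSpace3 F ι₁) (Dμ : (D F ι₁ V Φ).Obj),
          ∃ (M : Type) (_ : Field M) (_ : NumberField M) (_ : IsCMField M)
            (e : reflexField ℚ F (algValuedIn ι₁ (D F ι₁ V Φ).cmType.1) →+* M)
            (ιB : 𝓞 M →+* End (Aμ F ι₁ V Φ Dμ)) (θB : M →+* Module.End ℂ (complexBetti (Aμ F ι₁ V Φ Dμ).X 1)),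
            IsCMTypeRealisation (inducedCMType e (reflexCMType ι₁ (D F ι₁ V Φ).cmType (AlgHom.id ℚ F))) (Aμ F ι₁ V Φ Dμ) ιB θB) ∧
      (∀ (F : CMField), IsGalois ℚ F → 6 ≤ Module.finrank ℚ F → ∀ (Φ : CMType F) (ι₁ : F →+* ℂ), ι₁ ∈ Φ.1 →
        ∀ V : HermSpace3 F ι₁, ∃ Ksm : Subgroup (D F ι₁ V Φ).G, IsOpenCompact Ksm ∧
          ∀ (K : Subgroup (D F ι₁ V Φ).G) (Dμ : (D F ι₁ V Φ).Obj) (φ : (D F ι₁ V Φ).HomK K Dμ),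
            IsOpenCompact K → K ≤ Ksm → φ ≠ 0 →
              ∃ (Γ : Level V) (𝒥 : Jacobian (Var.scheme (ballQuotientUniformisedDatum_of h₁) h₃ (.pms (pmsCode F ι₁ V Γ))))
                (w : 𝒥.J ⟶ Aμ F ι₁ V Φ Dμ), w ≠ 0) := by
  classical
  -- per `(F, ι₁, Φ)`: a REAL weight-one conjugate symplectic character, of CM type `Φ^{*ι₁}` when `F/ℚ` is Galois
  have hμex : ∀ (F : CMField) (ι₁ : F →+* ℂ) (Φ : CMType F), ∃ μ : IdeleClassGroup F →ₜ* Circle,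
      ∃ hcs : IdeleClassGroup.IsConjugateSymplectic F μ, IdeleClassGroup.HasWeight F μ 1 ∧
        (IsGalois ℚ F → ∀ g : F ≃ₐ[ℚ] F,
          ι₁.comp (g : F →+* F) ∈ hcs.cmType.1 ↔ ι₁.comp (g.symm : F →+* F) ∈ Φ.1) := by
    intro F ι₁ Φ
    by_cases hG : IsGalois ℚ F
    · haveI := hG
      obtain ⟨μ, hcs, hw, hty⟩ :=
        IdeleClassGroup.exists_isConjugateSymplectic_hasCMType (L := F) (Transposition.invType ι₁ Φ)
      exact ⟨μ, hcs, hw, fun _ g => by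
        rw [hcs.cmType_eq hty]
        exact Transposition.comp_mem_invType_iff ι₁ Φ g⟩
    · obtain ⟨μ, hcs, hw, -⟩ := IdeleClassGroup.exists_isConjugateSymplectic_hasCMType (L := F) Φ
      exact ⟨μ, hcs, hw, fun h => absurd h hG⟩
  choose μ hcs hw hty using hμex
  -- the Shimura-free datum
  let T : ∀ (F : CMField) (_ : F →+* ℂ) (_ : CMType F), Thm418Data (maximalRealSubfield F) F := fun F ι₁ Φ =>
    { n := 2, two_le_n := le_rfl, 𝕍 := PUnit, G := PUnit, Eps := PUnit, epsOf := fun _ => PUnit.unit, Chi := PUnit,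
      μ := μ F ι₁ Φ, isConjugateSymplectic := hcs F ι₁ Φ, hasWeight_one := hw F ι₁ Φ, Obj := PUnit, omega := fun _ _ => ℂ,
      rho := fun _ _ => 1, Ω := fieldOfValues F (μ F ι₁ Φ), rhoΩ := 1, HomK := fun _ _ => fieldOfValues F (μ F ι₁ Φ),
      res := fun _ _ => AddMonoidHom.id _ }
  -- every subgroup of the trivial group is open compact
  have hoc : ∀ (F : CMField) (ι₁ : F →+* ℂ) (Φ : CMType F) (K : Subgroup (T F ι₁ Φ).G), IsOpenCompact K :=
    fun F ι₁ Φ K => ⟨isOpen_discrete _, (Set.toFinite _).isCompact⟩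
  -- the index set is a singleton
  have hne : ∀ (F : CMField) (ι₁ : F →+* ℂ) (Φ : CMType F), Nonempty (T F ι₁ Φ).AdmIndex := fun F ι₁ Φ => by
    obtain ⟨e, he⟩ := Literature.AlgebraicGeometry.Liu2021.exists_isAdmissibleElement_of_cmType
      (T F ι₁ Φ).cmType.1 (T F ι₁ Φ).cmType.2
    exact ⟨⟨(PUnit.unit, PUnit.unit), e, he, rfl⟩⟩
  have hss : ∀ (F : CMField) (ι₁ : F →+* ℂ) (Φ : CMType F), Subsingleton (T F ι₁ Φ).AdmIndex := fun F ι₁ Φ =>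
    ⟨fun _ _ => Subtype.ext (Subsingleton.elim _ _)⟩
  -- [Liu 2021, Thm. 4.18] AS TYPED holds for the toy datum
  have hLiuT : ∀ (F : CMField) (ι₁ : F →+* ℂ) (Φ : CMType F), Thm418AsPrinted (T F ι₁ Φ) := by
    intro F ι₁ Φ
    obtain ⟨i₀⟩ := hne F ι₁ Φ
    haveI := hss F ι₁ Φ
    haveI : Unique (T F ι₁ Φ).AdmIndex := { default := i₀, uniq := fun a => Subsingleton.elim _ _ }
    let Ψ : (ℂ ⊗[fieldOfValues F (μ F ι₁ Φ)] (T F ι₁ Φ).Ω) ≃ₗ[ℂ] (⨁ i : (T F ι₁ Φ).AdmIndex, (T F ι₁ Φ).omegaAt i) :=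
      (TensorProduct.AlgebraTensorModule.rid (fieldOfValues F (μ F ι₁ Φ)) ℂ ℂ).trans
        ((LinearEquiv.funUnique (T F ι₁ Φ).AdmIndex ℂ ℂ).symm.trans
          (DirectSum.linearEquivFunOnFintype ℂ (T F ι₁ Φ).AdmIndex fun i => (T F ι₁ Φ).omegaAt i).symm)
    refine ⟨Ψ, ?_, ?_, ?_, ?_⟩
    · -- «isomorphism of ℂ[G]-modules»: both actions are trivial
      intro g x i
      have h1 : ((T F ι₁ Φ).rhoΩ g).baseChange ℂ = LinearMap.id := by
        rw [show (T F ι₁ Φ).rhoΩ g = LinearMap.id from rfl, LinearMap.baseChange_id]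
      have h2 : (T F ι₁ Φ).rhoAt i g = LinearMap.id := rfl
      rw [h1, h2]
      rfl
    · -- (1): `res = id`, injective, image = everything = `Ω(μ)^K` (trivial action)
      intro Dμ
      refine ⟨⊤, hoc F ι₁ Φ _, fun K _ _ => ⟨fun a b h => h, ?_⟩⟩
      ext x
      exact ⟨fun _ k _ => rfl, fun _ => ⟨x, rfl⟩⟩
    · -- (2): one index
      exact fun i j _ => Subsingleton.elim i j
    · -- (3): `i.1.1 ≠ ε` is impossible in `PUnit`
      exact fun ε _ σ x _ i hi => absurd (Subsingleton.elim _ _) hi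
  -- the choice `hμ` for the toy datum (its `μ` was chosen of type `Φ^{*ι₁}`)
  have hLiuT' : ∀ (F : CMField), IsGalois ℚ F → 6 ≤ Module.finrank ℚ F → ∀ (Φ : CMType F) (ι₁ : F →+* ℂ), ι₁ ∈ Φ.1 →
      ∀ V : HermSpace3 F ι₁, Thm418AsPrinted ((fun F ι₁ _ Φ => T F ι₁ Φ) F ι₁ V Φ) :=
    fun F _ _ Φ ι₁ _ _ => hLiuT F ι₁ Φ
  have hObjT' : ∀ (F : CMField), IsGalois ℚ F → 6 ≤ Module.finrank ℚ F → ∀ (Φ : CMType F) (ι₁ : F →+* ℂ), ι₁ ∈ Φ.1 →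
      ∀ V : HermSpace3 F ι₁, Nonempty ((fun F ι₁ _ Φ => T F ι₁ Φ) F ι₁ V Φ).Obj :=
    fun _ _ _ _ _ _ _ => ⟨PUnit.unit⟩
  have hμT : ∀ (F : CMField), IsGalois ℚ F → 6 ≤ Module.finrank ℚ F → ∀ (Φ : CMType F) (ι₁ : F →+* ℂ), ι₁ ∈ Φ.1 →
      ∀ (V : HermSpace3 F ι₁) (g : F ≃ₐ[ℚ] F),
        ι₁.comp (g : F →+* F) ∈ ((fun F ι₁ _ Φ => T F ι₁ Φ) F ι₁ V Φ).cmType.1 ↔ ι₁.comp (g.symm : F →+* F) ∈ Φ.1 :=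
    fun F hG _ Φ ι₁ _ _ g => hty F ι₁ Φ hG g
  obtain ⟨Aμ, hCMT, hReachT⟩ := pinned_binders_of_faceSupply hHD hI h₁ h₃ (fun F ι₁ _ Φ => T F ι₁ Φ) hLiuT' hObjT' hμT hS
  exact ⟨fun F ι₁ _ Φ => T F ι₁ Φ, Aμ, hLiuT', hObjT', fun _ _ _ _ _ _ _ => ⟨PUnit.unit⟩,
    fun F _ _ Φ ι₁ _ _ i => isIrreducible_of_finrank_eq_one' _ (Module.finrank_self ℂ),
    fun F _ _ Φ ι₁ _ _ i v => ⟨⊤, (hoc F ι₁ Φ ⊤).1, fun _ _ => rfl⟩,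
    hμT, hCMT, hReachT⟩

/-! ## §4  CONSISTENCY, relative form: «∃ (D, Aμ), all eight binders» ↔ B01-S -/

/-- **CONSISTENCY CERTIFICATE, relative form** (`U = picardCMUniverse hHD hI h₁ h₃`; pub-hodgecm2 lead ACK condition (i); coordinator ruling
2026-08-21T15:33:56Z (3) «T5»): the EIGHT binders of `faceSupply_of_thm418AsPrinted_pinned` are jointly satisfiable by SOME `(D, Aμ)` iff the
displayed leaf B01-S `U.FaceSupply` holds (⇒ §1 of `Item6SupplyPinned.lean`; ⇐ `exists_pinnedDatum_of_faceSupply`).  Hence the binder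
family derives `False` exactly if B01-S is REFUTABLE on `U` — and the x2 refutation route (isotropic code over `ℚ(ζ₄)`, `H¹ = 0`) is closed
by the guard `6 ≤ [F:ℚ]` (stuck at `⊢ 6 ≤ 2`), as for the guarded `hMatch` family.  HC_CM is NOT proved. [folklore] -/
theorem exists_pinnedDatum_iff_faceSupply
    (hHD : exists_isReal_hodgeModel) (hI : hodgePQ_independent_of_hodgeModel)
    (h₁ : BallQuotientUniformised) (h₃ : CMAbelianVarietyRealised) :
    (∃ (D : ∀ (F : CMField) (ι₁ : F →+* ℂ) (_ : HermSpace3 F ι₁) (_ : CMType F), Thm418Data (maximalRealSubfield F) F)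
        (Aμ : ∀ (F : CMField) (ι₁ : F →+* ℂ) (V : HermSpace3 F ι₁) (Φ : CMType F), (D F ι₁ V Φ).Obj → AbelianVariety ℂ),
      (∀ (F : CMField), IsGalois ℚ F → 6 ≤ Module.finrank ℚ F → ∀ (Φ : CMType F) (ι₁ : F →+* ℂ), ι₁ ∈ Φ.1 →
        ∀ V : HermSpace3 F ι₁, Thm418AsPrinted (D F ι₁ V Φ)) ∧
      (∀ (F : CMField), IsGalois ℚ F → 6 ≤ Module.finrank ℚ F → ∀ (Φ : CMType F) (ι₁ : F →+* ℂ), ι₁ ∈ Φ.1 →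
        ∀ V : HermSpace3 F ι₁, Nonempty (D F ι₁ V Φ).Obj) ∧
      (∀ (F : CMField), IsGalois ℚ F → 6 ≤ Module.finrank ℚ F → ∀ (Φ : CMType F) (ι₁ : F →+* ℂ), ι₁ ∈ Φ.1 →
        ∀ V : HermSpace3 F ι₁, Nonempty (D F ι₁ V Φ).Chi) ∧
      (∀ (F : CMField), IsGalois ℚ F → 6 ≤ Module.finrank ℚ F → ∀ (Φ : CMType F) (ι₁ : F →+* ℂ), ι₁ ∈ Φ.1 →
        ∀ (V : HermSpace3 F ι₁) (i : (D F ι₁ V Φ).AdmIndex), ((D F ι₁ V Φ).rhoAt i).IsIrreducible) ∧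
      (∀ (F : CMField), IsGalois ℚ F → 6 ≤ Module.finrank ℚ F → ∀ (Φ : CMType F) (ι₁ : F →+* ℂ), ι₁ ∈ Φ.1 →
        ∀ (V : HermSpace3 F ι₁) (i : (D F ι₁ V Φ).AdmIndex) (v : (D F ι₁ V Φ).omegaAt i),
          ∃ S : Subgroup (D F ι₁ V Φ).G, IsOpen (S : Set (D F ι₁ V Φ).G) ∧ ∀ k ∈ S, (D F ι₁ V Φ).rhoAt i k v = v) ∧
      (∀ (F : CMField), IsGalois ℚ F → 6 ≤ Module.finrank ℚ F → ∀ (Φ : CMType F) (ι₁ : F →+* ℂ), ι₁ ∈ Φ.1 →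
        ∀ (V : HermSpace3 F ι₁) (g : F ≃ₐ[ℚ] F),
          ι₁.comp (g : F →+* F) ∈ (D F ι₁ V Φ).cmType.1 ↔ ι₁.comp (g.symm : F →+* F) ∈ Φ.1) ∧
      (∀ (F : CMField) [IsGalois ℚ F], 6 ≤ Module.finrank ℚ F → ∀ (Φ : CMType F) (ι₁ : F →+* ℂ), ι₁ ∈ Φ.1 →
        ∀ (V : HermSpace3 F ι₁) (Dμ : (D F ι₁ V Φ).Obj),
          ∃ (M : Type) (_ : Field M) (_ : NumberField M) (_ : IsCMField M)
            (e : reflexField ℚ F (algValuedIn ι₁ (D F ι₁ V Φ).cmType.1) →+* M)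
            (ιB : 𝓞 M →+* End (Aμ F ι₁ V Φ Dμ)) (θB : M →+* Module.End ℂ (complexBetti (Aμ F ι₁ V Φ Dμ).X 1)),
            IsCMTypeRealisation (inducedCMType e (reflexCMType ι₁ (D F ι₁ V Φ).cmType (AlgHom.id ℚ F))) (Aμ F ι₁ V Φ Dμ) ιB θB) ∧
      (∀ (F : CMField), IsGalois ℚ F → 6 ≤ Module.finrank ℚ F → ∀ (Φ : CMType F) (ι₁ : F →+* ℂ), ι₁ ∈ Φ.1 →
        ∀ V : HermSpace3 F ι₁, ∃ Ksm : Subgroup (D F ι₁ V Φ).G, IsOpenCompact Ksm ∧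
          ∀ (K : Subgroup (D F ι₁ V Φ).G) (Dμ : (D F ι₁ V Φ).Obj) (φ : (D F ι₁ V Φ).HomK K Dμ),
            IsOpenCompact K → K ≤ Ksm → φ ≠ 0 →
              ∃ (Γ : Level V) (𝒥 : Jacobian (Var.scheme (ballQuotientUniformisedDatum_of h₁) h₃ (.pms (pmsCode F ι₁ V Γ))))
                (w : 𝒥.J ⟶ Aμ F ι₁ V Φ Dμ), w ≠ 0)) ↔
      (picardCMUniverse hHD hI h₁ h₃).FaceSupply :=
  ⟨fun ⟨D, Aμ, hLiu, hObj, hChi, hirr, hsm, hμ, hCM, hReach⟩ =>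
      faceSupply_of_thm418AsPrinted_pinned hHD hI h₁ h₃ D Aμ hLiu hObj hChi hirr hsm hμ hCM hReach,
    exists_pinnedDatum_of_faceSupply hHD hI h₁ h₃⟩

end Data

/-! ## §5  On the universe of record -/

section EndState

/-- **The certificate on THE universe of record** (the four data the tree theorems `exists_isReal_hodgeModel_holds`,
`hodgePQ_independent_of_hodgeModel_holds`, `BallQuotient.ballQuotientUniformised_holds`, `cmAbelianVarietyRealised_holds`): «some `(D, Aμ)`
satisfies all eight binders of the pinned junction» ↔ `U_rec.FaceSupply` (B01-S).  HC_CM is NOT proved. [folklore] -/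
theorem exists_pinnedDatum_iff_faceSupply_rec :
    (∃ (D : ∀ (F : CMField) (ι₁ : F →+* ℂ) (_ : HermSpace3 F ι₁) (_ : CMType F), Thm418Data (maximalRealSubfield F) F)
        (Aμ : ∀ (F : CMField) (ι₁ : F →+* ℂ) (V : HermSpace3 F ι₁) (Φ : CMType F), (D F ι₁ V Φ).Obj → AbelianVariety ℂ),
      (∀ (F : CMField), IsGalois ℚ F → 6 ≤ Module.finrank ℚ F → ∀ (Φ : CMType F) (ι₁ : F →+* ℂ), ι₁ ∈ Φ.1 →
        ∀ V : HermSpace3 F ι₁, Thm418AsPrinted (D F ι₁ V Φ)) ∧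
      (∀ (F : CMField), IsGalois ℚ F → 6 ≤ Module.finrank ℚ F → ∀ (Φ : CMType F) (ι₁ : F →+* ℂ), ι₁ ∈ Φ.1 →
        ∀ V : HermSpace3 F ι₁, Nonempty (D F ι₁ V Φ).Obj) ∧
      (∀ (F : CMField), IsGalois ℚ F → 6 ≤ Module.finrank ℚ F → ∀ (Φ : CMType F) (ι₁ : F →+* ℂ), ι₁ ∈ Φ.1 →
        ∀ V : HermSpace3 F ι₁, Nonempty (D F ι₁ V Φ).Chi) ∧
      (∀ (F : CMField), IsGalois ℚ F → 6 ≤ Module.finrank ℚ F → ∀ (Φ : CMType F) (ι₁ : F →+* ℂ), ι₁ ∈ Φ.1 →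
        ∀ (V : HermSpace3 F ι₁) (i : (D F ι₁ V Φ).AdmIndex), ((D F ι₁ V Φ).rhoAt i).IsIrreducible) ∧
      (∀ (F : CMField), IsGalois ℚ F → 6 ≤ Module.finrank ℚ F → ∀ (Φ : CMType F) (ι₁ : F →+* ℂ), ι₁ ∈ Φ.1 →
        ∀ (V : HermSpace3 F ι₁) (i : (D F ι₁ V Φ).AdmIndex) (v : (D F ι₁ V Φ).omegaAt i),
          ∃ S : Subgroup (D F ι₁ V Φ).G, IsOpen (S : Set (D F ι₁ V Φ).G) ∧ ∀ k ∈ S, (D F ι₁ V Φ).rhoAt i k v = v) ∧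
      (∀ (F : CMField), IsGalois ℚ F → 6 ≤ Module.finrank ℚ F → ∀ (Φ : CMType F) (ι₁ : F →+* ℂ), ι₁ ∈ Φ.1 →
        ∀ (V : HermSpace3 F ι₁) (g : F ≃ₐ[ℚ] F),
          ι₁.comp (g : F →+* F) ∈ (D F ι₁ V Φ).cmType.1 ↔ ι₁.comp (g.symm : F →+* F) ∈ Φ.1) ∧
      (∀ (F : CMField) [IsGalois ℚ F], 6 ≤ Module.finrank ℚ F → ∀ (Φ : CMType F) (ι₁ : F →+* ℂ), ι₁ ∈ Φ.1 →
        ∀ (V : HermSpace3 F ι₁) (Dμ : (D F ι₁ V Φ).Obj),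
          ∃ (M : Type) (_ : Field M) (_ : NumberField M) (_ : IsCMField M)
            (e : reflexField ℚ F (algValuedIn ι₁ (D F ι₁ V Φ).cmType.1) →+* M)
            (ιB : 𝓞 M →+* End (Aμ F ι₁ V Φ Dμ)) (θB : M →+* Module.End ℂ (complexBetti (Aμ F ι₁ V Φ Dμ).X 1)),
            IsCMTypeRealisation (inducedCMType e (reflexCMType ι₁ (D F ι₁ V Φ).cmType (AlgHom.id ℚ F))) (Aμ F ι₁ V Φ Dμ) ιB θB) ∧
      (∀ (F : CMField), IsGalois ℚ F → 6 ≤ Module.finrank ℚ F → ∀ (Φ : CMType F) (ι₁ : F →+* ℂ), ι₁ ∈ Φ.1 →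
        ∀ V : HermSpace3 F ι₁, ∃ Ksm : Subgroup (D F ι₁ V Φ).G, IsOpenCompact Ksm ∧
          ∀ (K : Subgroup (D F ι₁ V Φ).G) (Dμ : (D F ι₁ V Φ).Obj) (φ : (D F ι₁ V Φ).HomK K Dμ),
            IsOpenCompact K → K ≤ Ksm → φ ≠ 0 →
              ∃ (Γ : Level V) (𝒥 : Jacobian (Var.scheme (ballQuotientUniformisedDatum_of BallQuotient.ballQuotientUniformised_holds) cmAbelianVarietyRealised_holds (.pms (pmsCode F ι₁ V Γ))))
                (w : 𝒥.J ⟶ Aμ F ι₁ V Φ Dμ), w ≠ 0)) ↔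
      (picardCMUniverse exists_isReal_hodgeModel_holds hodgePQ_independent_of_hodgeModel_holds
      BallQuotient.ballQuotientUniformised_holds cmAbelianVarietyRealised_holds).FaceSupply :=
  exists_pinnedDatum_iff_faceSupply _ _ _ _

end EndState

end Summit.HodgeConjecture.CorCM.Model

end
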